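import Summits.BirchSwinnertonDyer.Rank1Residual.AdditivePotMult.TwistSupplyJ
import Literature.NumberTheory.EllipticCurves.IsogenyHasCMIffJMemProofs
import Literature.NumberTheory.EllipticCurves.BSDSelmerSkinnerProofs
import HarnessLib

/-!
# X4(M): the `j`-DICHOTOMY — `BSD(E,p)` from the over-`K` input ALONE on X4(M) ∧ (`j`-witness), and
# on the complement every `p`-multiplicative twist is an X11 pair failing (ram)

HONEST FRAMING (cell `b2b-bsdres`, run/shared/lean/b2b/bsd-rank1-residual/, verbatim in every
file): the goal of the cell is to DELETE the COMBINATION-SHAPED residual classes of the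
Birch–Swinnerton-Dyer formula for ALL analytic-rank `≤ 1` elliptic curves over `ℚ` — "full BSD
formula for every rank `≤ 1` curve in class `C`" assembled STRICTLY from published theorems — so
that the rank-`≤ 1` remainder becomes exactly the CONSTRUCTION-SHAPED classes, which are TYPED
(missing-input `Prop`s), NOT attempted. This is not "finishing BSD". Sub-cell
`b2b-bsdres-additive-p1` (CLASS-OWNERS row "X3/X4 additive — pot. multiplicative / X3♯(M)"),
generation 4; research route, no claim beyond the stated sub-classes; X4(M) REMAINS
CONSTRUCTION-SHAPED.

Theorems only; no definition, no new named fact. Built on `TwistSupplyJ.lean` (the rank-zero (ram)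
`p`-multiplicative twist of an X4(M) pair with a `j`-WITNESS — a prime `q ≠ p` with `ord_q j(E) < 0`
and `p ∤ ord_q j(E)` — and the no-go for pairs without one):

* §6 **`bsdp_of_classX4M_of_jWitness`**: `ClassX4M W p → r_an(W) ≤ 1 → [binders] → (j-witness q) →
  (∀ K quadratic with E^{(d_K)} p-multiplicative, MissingPPartOverCAt (W.baseChange K) p) → BSDp W p`
  — the over-`K` input ALONE, uniformly, no census datum (Skinner 2016 Thm. C `hSk`, Milne 1972
  any-model `hMilneC`, GZK `hGZK`, modularity `hmod`/`hnf`, Hoffstein–Luo 1997 `hHL` as binders);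
  it SUPERSEDES gen 3's `bsdp_of_classX4M_of_ram` (`Ram W p` gives a `j`-witness,
  `exists_jWitness_of_ram`) and absorbs the 10 ‖ 0 census pairs whose (ram)-capable primes are all
  additive for `E`: X4(M) ∧ (`j`-witness) = 1683 ‖ 398 of the 1754 ‖ 418 pairs with
  `N < 2·10⁴ ‖ 10⁴`. Variants: `…_of_forall_quadratic`, `…_of_forall_ramified` (`p ∣ d_K`),
  `missingPPartAt_of_classX4M_of_jWitness` (Partition currency),
  `ClassX4M.exists_quadraticField_bsdp_iff_of_jWitness` (ONE quadratic `K`, ramified at `p`, with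
  `MissingPPartOverCAt (W.baseChange K) p ↔ BSDp W p`), and the one-sided
  `bsdp_of_classX4M_of_jWitness_of_lowerOverC_of_kim` (`r_an(E) = 0`, `p ≥ 5`, `ρ̄` onto, Manin,
  `p ∤ ∏ c_ℓ`: ONE inequality over the quadratic fields; Kim 2026 `hKim`).
* §7 **the dichotomy** `ClassX4M.jWitness_or_forall_twist_classX11_not_ram`: every X4(M) pair EITHER
  has a `j`-witness OR all its `p`-multiplicative quadratic twists (any globally minimal model) are
  X11 pairs FAILING (ram) — Skinner 2016 Thm. C reaches none of them, and the relocation needs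
  x11a's typed rank-zero input `X11RankZero.MissingInputAt` for the twist (71 ‖ 20 pairs:
  38 at `p = 3`, 21 at `5`, 5 at `7`, 7 at `p ≥ 11`); `bsdp_of_classX4M_dichotomy` is the all-pairs
  theorem consulting that input ONLY on the second branch.

* §8 `PotMult.not_hasCM`, `ClassX4M.not_classX12`, `ClassX3M.not_classX12` — CM `j`-invariants are
  integers (tree `exists_int_cast_eq_of_mem_cmJInvariants`, `hasCM_iff_j_mem_holds`), so the
  sub-cell never meets the partition's CM class X12 (grid bookkeeping).

So the conversion map of this sub-cell is now a DECIDABLE `j`-invariant criterion with a kernel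
proof on both sides: X4(M) ∧ (∃ q ≠ p: ord_q j < 0, p ∤ ord_q j) ⇒ over-`K` input alone;
X4(M) ∧ (∀ q ≠ p: ord_q j < 0 → p ∣ ord_q j) ⇒ over-`K` input + X11a input, the latter being
unavoidable ON THIS ROUTE (not claimed unavoidable mathematically). The located gap is unchanged:
the `p`-part of BSD over a quadratic field at a multiplicative prime RAMIFIED in the field
(printed nowhere; REPORT §4, §6.3). Labels UNCHANGED: X4(M) CONSTRUCTION-SHAPED; nothing booked.
-/

noncomputable section

open scoped Classical NumberField

open WeierstrassCurve Literature.NumberTheory.EllipticCurves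
  Literature.NumberTheory.EllipticCurves.ModularForms
  Literature.NumberTheory.EllipticCurves.Rank1Residual
  Literature.NumberTheory.EllipticCurves.Rank1Residual.Typed
  Literature.NumberTheory.EllipticCurves.Wuthrich2014
  IsDedekindDomain

namespace Summit.BirchSwinnertonDyer.Rank1Residual.AdditivePotMult

variable {W : WeierstrassCurve ℚ} [W.IsElliptic] {p : ℕ} [Fact p.Prime]

/-! ### §6 The class theorems on X4(M) ∧ (`j`-witness) -/

/-- **X4(M) ∧ (`j`-witness) ⇐ the over-`K` input over quadratic fields — uniformly, no census
datum.** Let `(E,p) ∈ X4(M)` (`W` globally minimal) have analytic rank `≤ 1`, and let `q ≠ p` be a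
prime with `ord_q j(E) < 0`, `p ∤ ord_q j(E)`. If `MissingPPartOverCAt (W.baseChange K) p` holds for
every quadratic field `K` whose twist `E^{(d_K)}` is multiplicative at `p`, then `BSD(E,p)` — Skinner
2016 Thm. C (`hSk`), Milne 1972 any-model (`hMilneC`), GZK (`hGZK`), modularity (`hmod`, `hnf`),
Hoffstein–Luo 1997 (`hHL`) as binders; the twist of
`ClassX4M.exists_ram_rankZero_mult_twist_of_jWitness` fed to gen 2's
`bsdp_of_classX4M_of_rankZero_twist'`. Supersedes gen 3's `bsdp_of_classX4M_of_ram` (a (ram) witness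
of `E` is a `j`-witness, `exists_jWitness_of_ram`). X4(M) stays CONSTRUCTION-SHAPED. [folklore] -/
theorem bsdp_of_classX4M_of_jWitness [W.IsGloballyMinimal]
    (hGZK : rank_eq_analyticRank_of_analyticRank_le_one) (hmod : hasEntireLFunction_rat)
    (hMilneC : Milne1972.bsdQuotient_baseChange_quadratic_anyModel)
    (hSk : Skinner2016.thmC_padicValRat_bsd_rank_zero)
    (hnf : exists_isNewformOf) (hHL : HoffsteinLuo1997_exists_twist_L_one_ne_zero)
    (hX : ClassX4M W p) (hr : W.analyticRank ≤ 1) {q : ℕ} (hq : q.Prime) (hqp : q ≠ p)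
    (hjq : padicValRat q W.j < 0) (hpj : ¬ (p : ℤ) ∣ padicValRat q W.j)
    (hK : ∀ (K : Type) [Field K] [NumberField K] (Wd : WeierstrassCurve ℚ) [Wd.IsElliptic]
      [Wd.IsGloballyMinimal], Module.finrank ℚ K = 2 →
      (∃ C : VariableChange ℚ, C • W.quadraticTwist (NumberField.discr K : ℚ) = Wd) →
      Mult Wd p → MissingPPartOverCAt (W.baseChange K) p) :
    BSDp W p := by
  obtain ⟨K, iF, iN, Wd, iWd, iWdm, h2, hWd, hmult, -, hram, hr0⟩ :=
    hX.exists_ram_rankZero_mult_twist_of_jWitness hq hqp hjq hpj hnf hHL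
  exact bsdp_of_classX4M_of_rankZero_twist' W p K Wd hGZK hmod hMilneC hSk hX hr h2 hWd hmult hram hr0
    (hK K Wd h2 hWd hmult)

/-- The same with the plainer hypothesis "the `p`-part of BSD for `E` over every quadratic field".
[folklore] -/
theorem bsdp_of_classX4M_of_jWitness_of_forall_quadratic [W.IsGloballyMinimal]
    (hGZK : rank_eq_analyticRank_of_analyticRank_le_one) (hmod : hasEntireLFunction_rat)
    (hMilneC : Milne1972.bsdQuotient_baseChange_quadratic_anyModel)
    (hSk : Skinner2016.thmC_padicValRat_bsd_rank_zero)
    (hnf : exists_isNewformOf) (hHL : HoffsteinLuo1997_exists_twist_L_one_ne_zero)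
    (hX : ClassX4M W p) (hr : W.analyticRank ≤ 1) {q : ℕ} (hq : q.Prime) (hqp : q ≠ p)
    (hjq : padicValRat q W.j < 0) (hpj : ¬ (p : ℤ) ∣ padicValRat q W.j)
    (hK : ∀ (K : Type) [Field K] [NumberField K], Module.finrank ℚ K = 2 →
      MissingPPartOverCAt (W.baseChange K) p) :
    BSDp W p :=
  bsdp_of_classX4M_of_jWitness hGZK hmod hMilneC hSk hnf hHL hX hr hq hqp hjq hpj
    fun K _ _ _ _ _ h2 _ _ ↦ hK K h2

/-- The same with the hypothesis "the `p`-part of BSD for `E` over every quadratic field RAMIFIED at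
`p`" (the fields of the relocation are ramified at `p`, `dvd_discr_of_mult_twist`). [folklore] -/
theorem bsdp_of_classX4M_of_jWitness_of_forall_ramified [W.IsGloballyMinimal]
    (hGZK : rank_eq_analyticRank_of_analyticRank_le_one) (hmod : hasEntireLFunction_rat)
    (hMilneC : Milne1972.bsdQuotient_baseChange_quadratic_anyModel)
    (hSk : Skinner2016.thmC_padicValRat_bsd_rank_zero)
    (hnf : exists_isNewformOf) (hHL : HoffsteinLuo1997_exists_twist_L_one_ne_zero)
    (hX : ClassX4M W p) (hr : W.analyticRank ≤ 1) {q : ℕ} (hq : q.Prime) (hqp : q ≠ p)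
    (hjq : padicValRat q W.j < 0) (hpj : ¬ (p : ℤ) ∣ padicValRat q W.j)
    (hK : ∀ (K : Type) [Field K] [NumberField K], Module.finrank ℚ K = 2 →
      (p : ℤ) ∣ NumberField.discr K → MissingPPartOverCAt (W.baseChange K) p) :
    BSDp W p :=
  bsdp_of_classX4M_of_jWitness hGZK hmod hMilneC hSk hnf hHL hX hr hq hqp hjq hpj
    fun K _ _ Wd _ _ h2 hWd hmult ↦
      hK K h2 (dvd_discr_of_mult_twist hX.potMult.not_mult hX.p_ne_two K Wd hWd hmult)

/-- The X4(M) ∧ (`j`-witness) theorem in the cell's `MissingPPartAt` currency (Partition /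
additive-p4's `X4Sharp` bookkeeping). [folklore] -/
theorem missingPPartAt_of_classX4M_of_jWitness [W.IsGloballyMinimal]
    (hGZK : rank_eq_analyticRank_of_analyticRank_le_one) (hmod : hasEntireLFunction_rat)
    (hMilneC : Milne1972.bsdQuotient_baseChange_quadratic_anyModel)
    (hSk : Skinner2016.thmC_padicValRat_bsd_rank_zero)
    (hnf : exists_isNewformOf) (hHL : HoffsteinLuo1997_exists_twist_L_one_ne_zero)
    (hX : ClassX4M W p) (hr : W.analyticRank ≤ 1) {q : ℕ} (hq : q.Prime) (hqp : q ≠ p)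
    (hjq : padicValRat q W.j < 0) (hpj : ¬ (p : ℤ) ∣ padicValRat q W.j)
    (hK : ∀ (K : Type) [Field K] [NumberField K] (Wd : WeierstrassCurve ℚ) [Wd.IsElliptic]
      [Wd.IsGloballyMinimal], Module.finrank ℚ K = 2 →
      (∃ C : VariableChange ℚ, C • W.quadraticTwist (NumberField.discr K : ℚ) = Wd) →
      Mult Wd p → MissingPPartOverCAt (W.baseChange K) p) :
    MissingPPartAt W p := by
  haveI : Finite W.sha := (hGZK W hr).2
  exact missingPPartAt_of_bsdp W p
    (bsdp_of_classX4M_of_jWitness hGZK hmod hMilneC hSk hnf hHL hX hr hq hqp hjq hpj hK)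

/-- **X4(M) ∧ (`j`-witness): one quadratic field over which `BSD(E,p)` ⟺ the over-`K` input** —
the honest shape of the relocation (gen 2's exactness `missingPPartOverCAt_baseChange_iff_bsdp` and
Skinner 2016 Thm. C for the twist, `bsdp_twist_of_rankZero_ram`). [folklore] -/
theorem ClassX4M.exists_quadraticField_bsdp_iff_of_jWitness [W.IsGloballyMinimal]
    (hGZK : rank_eq_analyticRank_of_analyticRank_le_one) (hmod : hasEntireLFunction_rat)
    (hMilneC : Milne1972.bsdQuotient_baseChange_quadratic_anyModel)
    (hSk : Skinner2016.thmC_padicValRat_bsd_rank_zero)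
    (hnf : exists_isNewformOf) (hHL : HoffsteinLuo1997_exists_twist_L_one_ne_zero)
    (hX : ClassX4M W p) (hr : W.analyticRank ≤ 1) {q : ℕ} (hq : q.Prime) (hqp : q ≠ p)
    (hjq : padicValRat q W.j < 0) (hpj : ¬ (p : ℤ) ∣ padicValRat q W.j) :
    ∃ (K : Type) (_ : Field K) (_ : NumberField K), Module.finrank ℚ K = 2 ∧
      (p : ℤ) ∣ NumberField.discr K ∧
      (∃ (Wd : WeierstrassCurve ℚ) (_ : Wd.IsElliptic) (_ : Wd.IsGloballyMinimal),
        (∃ C : VariableChange ℚ, C • W.quadraticTwist (NumberField.discr K : ℚ) = Wd) ∧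
        Mult Wd p ∧ Irr Wd p ∧ Ram Wd p ∧ Wd.analyticRank = 0) ∧
      (MissingPPartOverCAt (W.baseChange K) p ↔ BSDp W p) := by
  obtain ⟨K, iF, iN, Wd, iWd, iWdm, h2, hWd, hmult, hirr, hramd, hr0⟩ :=
    hX.exists_ram_rankZero_mult_twist_of_jWitness hq hqp hjq hpj hnf hHL
  have hd : BSDp Wd p := bsdp_twist_of_rankZero_ram p Wd hSk hGZK hmod hX.p_ne_two hmult hirr hramd hr0
  exact ⟨K, iF, iN, h2, dvd_discr_of_mult_twist hX.potMult.not_mult hX.p_ne_two K Wd hWd hmult,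
    ⟨Wd, iWd, iWdm, hWd, hmult, hirr, hramd, hr0⟩,
    missingPPartOverCAt_baseChange_iff_bsdp W p K Wd hGZK hmod hMilneC hr h2 hWd
      (by rw [hr0]; exact zero_le_one) hd⟩

/-- **X4(M) ∧ (`j`-witness) ∩ {`r_an(E) = 0`, `p ≥ 5`, `ρ̄_{E,p}` onto, `p ∤ c_D`, `p ∤ ∏ c_ℓ(E)`}:
`BSD(E,p)` from ONE inequality over the quadratic fields, uniformly** — the upper half over `ℚ` being
Kim 2026 Thm. 1.8 (6) (`hKim`, additive-p4's `X4RankZero`); gen 2's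
`bsdp_of_classX4M_of_lowerOverC_of_kim` on the twist of
`ClassX4M.exists_ram_rankZero_mult_twist_of_jWitness`. [folklore] -/
theorem bsdp_of_classX4M_of_jWitness_of_lowerOverC_of_kim [W.IsGloballyMinimal]
    (hKim : Kim2026.rankZero_padicValNat_sha_le_of_maninConstant)
    (hGZK : rank_eq_analyticRank_of_analyticRank_le_one) (hmod : hasEntireLFunction_rat)
    (hMilneC : Milne1972.bsdQuotient_baseChange_quadratic_anyModel)
    (hSk : Skinner2016.thmC_padicValRat_bsd_rank_zero)
    (hnf : exists_isNewformOf) (hHL : HoffsteinLuo1997_exists_twist_L_one_ne_zero)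
    (hX : ClassX4M W p) {q : ℕ} (hq : q.Prime) (hqp : q ≠ p)
    (hjq : padicValRat q W.j < 0) (hpj : ¬ (p : ℤ) ∣ padicValRat q W.j)
    (hp5 : 5 ≤ p) (hrW : W.analyticRank = 0)
    (hsurj : Surj W p) {N : ℕ} [NeZero N] (D : ModularParametrizationData W N)
    (hc : ¬ (p : ℤ) ∣ D.maninConstant) (htam : ¬ p ∣ W.tamagawaProduct)
    (hK : ∀ (K : Type) [Field K] [NumberField K] (Wd : WeierstrassCurve ℚ) [Wd.IsElliptic]
      [Wd.IsGloballyMinimal], Module.finrank ℚ K = 2 →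
      (∃ C : VariableChange ℚ, C • W.quadraticTwist (NumberField.discr K : ℚ) = Wd) →
      Mult Wd p → MissingLowerBoundOverCAt (W.baseChange K) p) :
    BSDp W p := by
  obtain ⟨K, iF, iN, Wd, iWd, iWdm, h2, hWd, hmult, -, hramd, hr0⟩ :=
    hX.exists_ram_rankZero_mult_twist_of_jWitness hq hqp hjq hpj hnf hHL
  exact bsdp_of_classX4M_of_lowerOverC_of_kim W p K Wd hKim hGZK hmod hMilneC hSk hX hp5 hrW hsurj D hc
    htam h2 hWd hmult hramd hr0 (hK K Wd h2 hWd hmult)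

/-! ### §7 The dichotomy: `j`-witness, or every `p`-multiplicative twist is an X11 pair failing (ram) -/

/-- **The complement twists only into X11 ∧ ¬(ram).** If `(E,p) ∈ X4(M)` has NO `j`-witness
(every prime `q ≠ p` with `ord_q j(E) < 0` has `p ∣ ord_q j(E)`), then every globally minimal model
`Wd` of a quadratic twist `E^{(d)}` that is multiplicative at `p` lies in class X11 at `p` and FAILS
(ram): it is an X11a-type pair whenever its analytic rank is `0`. So on this sub-population
(71 ‖ 20 census pairs) the route needs x11a's typed input for the twist (`bsdp_of_classX4M`), not
by a search bound but structurally. [folklore] -/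
theorem ClassX4M.classX11_and_not_ram_twist_of_forall_dvd [W.IsGloballyMinimal] (hX : ClassX4M W p)
    (hall : ∀ q : ℕ, q.Prime → q ≠ p → padicValRat q W.j < 0 → (p : ℤ) ∣ padicValRat q W.j)
    {d : ℚ} (hd : d ≠ 0) (Wd : WeierstrassCurve ℚ) [Wd.IsElliptic] [Wd.IsGloballyMinimal]
    (hWd : ∃ C : VariableChange ℚ, C • W.quadraticTwist d = Wd) (hmult : Mult Wd p) :
    ClassX11 Wd p ∧ ¬ Ram Wd p := by
  have hram : ¬ Ram Wd p := not_ram_model_twist_of_forall_dvd hall hd Wd hWd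
  exact ⟨⟨hmult, (irr_iff_of_model_twist hd hWd).mpr hX.irr, Or.inl hram⟩, hram⟩

/-- **The `j`-dichotomy of X4(M)** (kernel form of the census map, REPORT §7.2): for every
`(E,p) ∈ X4(M)`, EITHER `E` has a `j`-witness `q` — and then `BSD(E,p)` follows from the over-`K`
input over quadratic fields ALONE (`bsdp_of_classX4M_of_jWitness`; census 1683 ‖ 398 of the
1754 ‖ 418 pairs with `N < 2·10⁴ ‖ 10⁴`) — OR every `p`-multiplicative quadratic twist of `E` (on
any globally minimal model) is an X11 pair failing (ram), so that Skinner 2016 Thm. C covers none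
of them and the relocation needs x11a's typed rank-zero input as well (`bsdp_of_classX4M`;
71 ‖ 20 pairs). Labels UNCHANGED: X4(M) CONSTRUCTION-SHAPED. [folklore] -/
theorem ClassX4M.jWitness_or_forall_twist_classX11_not_ram [W.IsGloballyMinimal]
    (hX : ClassX4M W p) :
    (∃ q : ℕ, q.Prime ∧ q ≠ p ∧ padicValRat q W.j < 0 ∧ ¬ (p : ℤ) ∣ padicValRat q W.j) ∨
    (∀ (d : ℚ), d ≠ 0 → ∀ (Wd : WeierstrassCurve ℚ) [Wd.IsElliptic] [Wd.IsGloballyMinimal],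
      (∃ C : VariableChange ℚ, C • W.quadraticTwist d = Wd) → Mult Wd p →
      ClassX11 Wd p ∧ ¬ Ram Wd p) := by
  by_cases h : ∃ q : ℕ, q.Prime ∧ q ≠ p ∧ padicValRat q W.j < 0 ∧ ¬ (p : ℤ) ∣ padicValRat q W.j
  · exact Or.inl h
  · push Not at h
    exact Or.inr fun d hd Wd _ _ hWd hmult ↦
      hX.classX11_and_not_ram_twist_of_forall_dvd h hd Wd hWd hmult

/-- **X4(M), all pairs, read through the dichotomy**: `BSD(E,p)` from the over-`K` input over the
quadratic fields whose twist is `p`-multiplicative, plus x11a's typed rank-zero input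
`X11RankZero.MissingInputAt` granted ONLY for the `p`-multiplicative twists of `E` itself that fail
(ram) — a hypothesis which is VACUOUS on the `j`-witness branch is not even consulted there
(Wuthrich 2014 Prop. 21 `hW` rides with the X11 input as in `bsdp_of_classX4M`). [folklore] -/
theorem bsdp_of_classX4M_dichotomy [W.IsGloballyMinimal]
    (hGZK : rank_eq_analyticRank_of_analyticRank_le_one) (hmod : hasEntireLFunction_rat)
    (hMilneC : Milne1972.bsdQuotient_baseChange_quadratic_anyModel)
    (hSk : Skinner2016.thmC_padicValRat_bsd_rank_zero) (hW : sha_dvd_analyticSha)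
    (hnf : exists_isNewformOf) (hHL : HoffsteinLuo1997_exists_twist_L_one_ne_zero)
    (hX : ClassX4M W p) (hr : W.analyticRank ≤ 1)
    (hK : ∀ (K : Type) [Field K] [NumberField K] (Wd : WeierstrassCurve ℚ) [Wd.IsElliptic]
      [Wd.IsGloballyMinimal], Module.finrank ℚ K = 2 →
      (∃ C : VariableChange ℚ, C • W.quadraticTwist (NumberField.discr K : ℚ) = Wd) →
      Mult Wd p → MissingPPartOverCAt (W.baseChange K) p)
    (hX11 : (∀ q : ℕ, q.Prime → q ≠ p → padicValRat q W.j < 0 → (p : ℤ) ∣ padicValRat q W.j) →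
      ∀ (d : ℚ), d ≠ 0 → ∀ (Wd : WeierstrassCurve ℚ) [Wd.IsElliptic] [Wd.IsGloballyMinimal],
      (∃ C : VariableChange ℚ, C • W.quadraticTwist d = Wd) → Mult Wd p → ¬ Ram Wd p →
      Wd.analyticRank = 0 → X11RankZero.MissingInputAt Wd p) :
    BSDp W p := by
  by_cases h : ∃ q : ℕ, q.Prime ∧ q ≠ p ∧ padicValRat q W.j < 0 ∧ ¬ (p : ℤ) ∣ padicValRat q W.j
  · obtain ⟨q, hq, hqp, hjq, hpj⟩ := h
    exact bsdp_of_classX4M_of_jWitness hGZK hmod hMilneC hSk hnf hHL hX hr hq hqp hjq hpj hK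
  · push Not at h
    have hp2 : p ≠ 2 := hX.p_ne_two
    obtain ⟨K, iF, iN, Wd, iWd, iWdm, h2, hWd, hmult, hirr, hr0⟩ :=
      hX.exists_rankZero_mult_twist hnf hHL
    have hD : (NumberField.discr K : ℚ) ≠ 0 := by exact_mod_cast NumberField.discr_ne_zero K
    have hram : ¬ Ram Wd p := not_ram_model_twist_of_forall_dvd h hD Wd hWd
    have hX11d : ClassX11 Wd p := ⟨hmult, hirr, Or.inl hram⟩
    have hd : BSDp Wd p :=
      X11RankZero.bsdp_of_missingInputAt hW hGZK hmod Wd p hp2 hr0 hX11d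
        (hX11 h (NumberField.discr K : ℚ) hD Wd hWd hmult hram hr0)
    exact bsdp_of_pPartOverC_baseChange W p K Wd hGZK hmod hMilneC hr h2 hWd
      (by rw [hr0]; exact zero_le_one) (hK K Wd h2 hWd hmult) hd

/-! ### §8 X3♯(M) / X4(M) never meet the CM class X12 (grid bookkeeping) -/

omit [Fact p.Prime] in
/-- **`ord_p j(E) < 0` at some prime ⇒ `E` has no complex multiplication** (CM `j`-invariants are
integers: Silverman *AEC* App. C §11, tree theorem `WeierstrassCurve.hasCM_iff_j_mem_holds`).
[folklore] -/
theorem not_hasCM_of_padicValRat_j_neg (h : padicValRat p W.j < 0) : ¬ W.HasCM := by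
  intro hcm
  obtain ⟨n, hn⟩ :=
    exists_int_cast_eq_of_mem_cmJInvariants ((WeierstrassCurve.hasCM_iff_j_mem_holds W).mp hcm)
  rw [← hn, padicValRat.of_int] at h
  exact absurd h (not_lt.mpr (Int.natCast_nonneg _))

/-- A potentially multiplicative pair is non-CM. [folklore] -/
theorem PotMult.not_hasCM (h : PotMult W p) : ¬ W.HasCM := not_hasCM_of_padicValRat_j_neg h.2

/-- **X4(M) and X12 are disjoint** (X12 is the CM class of the partition): the grid's CM column
never meets this sub-cell. [folklore] -/
theorem ClassX4M.not_classX12 (hX : ClassX4M W p) : ¬ ClassX12 W p :=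
  fun h ↦ hX.potMult.not_hasCM h.1

/-- **X3♯(M) and X12 are disjoint.** [folklore] -/
theorem ClassX3M.not_classX12 [W.IsGloballyMinimal] (hX : ClassX3M W p) : ¬ ClassX12 W p :=
  fun h ↦ hX.potMult.not_hasCM h.1

end Summit.BirchSwinnertonDyer.Rank1Residual.AdditivePotMult

end
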